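import Mathlib
import Literature.Analysis.FluidPDE.VectorCalculus
import Literature.Analysis.FluidPDE.VorticityCalculus
import Literature.Analysis.FluidPDE.VorticityStretching
import Literature.Analysis.FluidPDE.AncientSimilarityVorticity
import Literature.Analysis.FluidPDE.BiotSavartNewtonKernel
import Literature.Geometry.DiscreteGeometry.LayerShells
import Summits.NavierStokesRegularity.NavierStokesRegularity.Theorems.ThreadingFluxAzimuthalCartanDefs
import Summits.NavierStokesRegularity.NavierStokesRegularity.Theorems.ThreadingFluxAzimuthalCartanLocalCurlCurl
import Summits.NavierStokesRegularity.NavierStokesRegularity.Theorems.ThreadingFluxAzimuthalCartanConicalCorrespondence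
import Summits.NavierStokesRegularity.NavierStokesRegularity.Theorems.ThreadingFluxAzimuthalCartanConicalHead
import Summits.NavierStokesRegularity.NavierStokesRegularity.Theorems.ThreadingFluxHorizonTowerZonalForm
import Summits.NavierStokesRegularity.NavierStokesRegularity.Theorems.UnthreadedDoorKinematicShadowPointSourceCalculus
import HarnessLib

/-!
# Crux `PoloidalLiouville` (stmt-NavierStokesRegularity-1222, wall W1), crux idea «azimuthal-cartan-test» (ns-idea-15 g10):
# ŠVERÁK'S BERNOULLI HEAD IS A FIRST INTEGRAL OF THE UNTHREADED `(−1)`-HOMOGENEOUS STEADY STRATUM ON A CONE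

Support file (`--supports stmt-NavierStokesRegularity-1222`, helper; cell `ns-wall-extremal`, width hand ns-wall-eng-6 g8, 0 kit).  (Λ5a) of
the eng-6 lineage: first half of the local converse of Šverák's conformal correspondence (`LiouvilleCone.correspondence`, C2).

SETTING — the stratum itself, no ansatz: `U ⊆ ℝ³` open, `(u, p)` a classical steady Navier–Stokes pair on `U` (`IsSteadyNSOn U u p`: `ν = 1`,
`u ∈ C³`, `p ∈ C¹`, `div u = 0`, momentum as `Du(x)(u x) + ∇p(x) = Δu(x)` with Mathlib's `Laplacian.laplacian`), `(−1)`-HOMOGENEOUS about the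
vertex `0` (`IsMinusOneHomogeneousOn U 0 u`: `Du(x) x = −u(x)`; pressure normalised `(−2)`-homogeneous, `Dp(x) x = −2p(x)` — its additive
constant is free otherwise, cf. `exists_pressure_eq_add`) and UNTHREADED about the vertex (`IsUnthreadedOn U 0 u`: `⟪x, curl u(x)⟫ = 0`).
Šverák (arXiv:math/0604550 §4) treats `U = ℝ³ ∖ {0}` through the `0`-homogeneous head `K = |x|²(½|u|² + p) − ½F² − F`, `F = ⟪x, u⟫` (tree:
`conicalHead`; `Literature…Sverak2011.bernoulliK_const_and_radVort_eq_zero`, where `ΔK − u·∇K = ⟪x, curl u⟫²` on all of `S²` plus the maximum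
principle give `K ≡ const` and unthreadedness at once).  HERE: on ANY open cone, once the flow is UNTHREADED, `K` is a POINTWISE first
integral — no maximum principle, no integration (for threaded homogeneous flows it is not: unthreadedness is essential throughout):

* `inner_apply_sub_inner_apply_eq` — the spin identity `⟪a, D w⟫ − ⟪D a, w⟫ = ⟪a × curlCLM D, w⟫` (how the antisymmetric part of `Du` enters;
  no Lamb form is used);
* ★ `hasFDerivAt_inner_self` / `gradient_inner_self` — from Euler's relation alone, `∇⟪x, u⟫ = x × curl u`; hence `⟪x, ∇F⟫ = 0` and, with
  unthreadedness, `curl u = (∇F × x)/|x|²` (`curl_eq_of_unthreaded`: the vorticity of the stratum is DETERMINED by its radial profile);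
* `fderiv_gradient_apply_self_of_inner_gradient_eq_zero` — Euler for the gradient of a `0`-homogeneous `C²` function, locally;
* ★★ `laplacian_eq_of_unthreaded` — the one second-order fact, for `u ∈ C²(U)`: `Δu = (∇F + (div ∇F) x)/|x|²` (ns-wall-eng-7's LOCAL
  `Δu = −curl ω`, `LocalCurlCurl.laplacian_eq_neg_curl_local`, by name; `curl((∇F × y)/|y|²)` by the tree's `curl_smul` / `curl_cross_apply`);
* ★★★ `hasFDerivAt_conicalHead` — **`D(conicalHead u p)(x) = 0` at every `x ∈ U ∖ {0}`**: with `g = ∇F`, `m = div ∇F`,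
  `K'w = 2⟪x,w⟫(½|u|²+p) + |x|²(⟪u, Du w⟫ + Dp w) − (F+1)⟪g, w⟫`; the spin identity, the momentum equation, the Laplacian formula and
  `u × ω = (F g − ⟪u,g⟫ x)/|x|²` collapse it to `⟪x, w⟫(|u|² + 2p + m − ⟪u, g⟫)`, and the bracket is the radial momentum balance;
* `exists_conicalHead_eq_const` — on a preconnected `U ∌ 0` the head is a constant `k₀` (Šverák's `k₀`; `= 0` on the image of the
  correspondence by `LiouvilleCone.conicalHead_eq_zero` (Λ4a), `= β − β²/2` on the Slezkin members (Λ4c));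
* `LiouvilleCone.exists_ne_conicalField_of_conicalHead_ne_zero` — Λ4a's HEAD OBSTRUCTION with its constancy hypothesis discharged.

READING (information-grade; W1 movement 0).  Locally the UNTHREADED `(−1)`-homogeneous steady stratum is Šverák's system
`{Δ_{S²}φ = 2 − w, −Δ_{S²}w + div(w∇φ) = 2k₀}`, `k₀ =` the head; this file supplies `k₀` (the sequels supply `φ` on CONVEX open cones and the
two equations).  HONEST FRAME / LABEL (critic BATCH #25 (P4)): SCOPE/SPECIAL-class support (steady `(−1)`-homogeneous unthreaded class),
information-grade, explicit local vector calculus strictly below W1; closes no crux and no sketch Prop; W1 movement 0; `PoloidalLiouville`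
(1222), C♯, I♭ and NS regularity are OPEN / NOT proved.

## References
* V. Šverák, On Landau's solutions of the Navier–Stokes equations, J. Math. Sci. 179 (2011) 208–228, arXiv:math/0604550, §4 (Lemma 1,
  the Bernoulli quantity `½|v|² + p − f`). [Sverak2011]
* A. J. Majda, A. L. Bertozzi, Vorticity and Incompressible Flow (CUP 2002), §1.1 (vector identities). [MajdaBertozziCUP2002]
-/

-- the summit and its single sub-problem share the name (CONVENTIONS §1)
set_option linter.dupNamespace false

noncomputable section

namespace Summit.NavierStokesRegularity.NavierStokesRegularity.Theorems.PoloidalLiouville.AzimuthalCartan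

open Set Function Filter Topology Metric
open scoped RealInnerProductSpace ContDiff
open Literature.Analysis.FluidPDE
open Literature.Geometry.DiscreteGeometry (inner_fin3 norm_sq_fin3)
open Summit.NavierStokesRegularity.NavierStokesRegularity.Theorems.PoloidalLiouville.CentreJet (E3 IsSteadyNSOn)
open Summit.NavierStokesRegularity.NavierStokesRegularity.Cruxes.ScarEnvelopeTypeI.ForcedTsai
  (gradient_eq_of_hasFDerivAt_innerSL fderiv_eq_innerSL_gradient')
open Summit.NavierStokesRegularity.NavierStokesRegularity.Theorems.PoloidalLiouville.HorizonTower (inner_cross_self_right cross_fin3)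
open Summit.NavierStokesRegularity.NavierStokesRegularity.Theorems.PoloidalLiouville.AzimuthalCartan.LocalCurlCurl
  (laplacian_eq_neg_curl_local)
open Summit.NavierStokesRegularity.NavierStokesRegularity.Theorems.PoloidalLiouville.KinematicShadow.PointSource (divergence_id)

/-! ### Pointwise linear algebra in `ℝ³` -/

/-- **The spin identity**: for a `3 × 3` matrix `D`, `⟪a, D w⟫ − ⟪D a, w⟫ = ⟪a × curlCLM D, w⟫` — the antisymmetric part of `D` acts as
`w ↦ (curlCLM D) × w` (Majda–Bertozzi (1.24)). -/
theorem inner_apply_sub_inner_apply_eq (D : E3 →L[ℝ] E3) (a w : E3) :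
    ⟪a, D w⟫ - ⟪D a, w⟫ = ⟪cross a (curlCLM D), w⟫ := by
  obtain ⟨c0, c1, c2⟩ := cross_fin3 a (curlCLM D)
  rw [inner_fin3, inner_fin3, inner_fin3, c0, c1, c2]
  rw [clm_apply_coord D w 0, clm_apply_coord D w 1, clm_apply_coord D w 2, clm_apply_coord D a 0, clm_apply_coord D a 1,
    clm_apply_coord D a 2]
  simp only [Fin.sum_univ_three, curlCLM_apply, PiLp.toLp_apply, Matrix.cons_val_zero, Matrix.cons_val_one, Matrix.cons_val_two,
    Matrix.head_cons, Matrix.tail_cons]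
  ring

/-- Inverting `g = x × ω` on the tangent plane: if `⟪x, ω⟫ = 0` and `x ≠ 0` then `ω = (g × x)/|x|²`. -/
theorem eq_inv_norm_sq_smul_cross_of_eq_cross {x b g : E3} (hx : x ≠ 0) (hb : ⟪x, b⟫ = 0) (hg : g = cross x b) :
    b = (‖x‖ ^ 2)⁻¹ • cross g x := by
  have hr : ‖x‖ ^ 2 ≠ 0 := pow_ne_zero 2 (norm_ne_zero_iff.mpr hx)
  rw [hg, cross_swap (cross x b) x, cross_cross_eq, hb, zero_smul, zero_sub, neg_neg, real_inner_self_eq_norm_sq, smul_smul,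
    inv_mul_cancel₀ hr, one_smul]

/-! ### First order: the radial profile is a potential for `x × ω` -/

section FirstOrder

variable {u : E3 → E3} {x : E3} {D : E3 →L[ℝ] E3}

/-- ★ **`∇⟪x, u⟫ = x × curl u` from Euler's relation alone.**  If `u` has derivative `D` at `x` with `D x = −u(x)`, then
`y ↦ ⟪y, u y⟫` has derivative `⟪x × curlCLM D, ·⟫` at `x` (`D⟪y,u⟫ w = ⟪w, u⟫ + ⟪x, D w⟫ = ⟪w,u⟫ + ⟪D x, w⟫ + ⟪x × ω, w⟫`). -/
theorem hasFDerivAt_inner_self (hu : HasFDerivAt u D x) (hEu : D x = -u x) :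
    HasFDerivAt (fun y : E3 => ⟪y, u y⟫) (innerSL ℝ (cross x (curlCLM D))) x := by
  have h := (hasFDerivAt_id x).inner ℝ hu
  refine h.congr_fderiv ?_
  ext w
  simp only [ContinuousLinearMap.coe_comp, Function.comp_apply, ContinuousLinearMap.prod_apply, ContinuousLinearMap.coe_id', id,
    fderivInnerCLM_apply, innerSL_apply_apply]
  rw [← inner_apply_sub_inner_apply_eq D x w, hEu, inner_neg_left, real_inner_comm (u x) w]
  ring

/-- The gradient form: `∇⟪x, u⟫(x) = x × curl u(x)`. -/
theorem gradient_inner_self (hu : HasFDerivAt u D x) (hEu : D x = -u x) :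
    gradient (fun y : E3 => ⟪y, u y⟫) x = cross x (curl u x) := by
  rw [curl_eq_curlCLM, hu.fderiv]
  exact gradient_eq_of_hasFDerivAt_innerSL (hasFDerivAt_inner_self hu hEu)

/-- `⟪x, ∇⟪x, u⟫⟫ = 0`: the radial profile is infinitesimally `0`-homogeneous. -/
theorem inner_self_gradient_inner_self (hu : HasFDerivAt u D x) (hEu : D x = -u x) :
    ⟪x, gradient (fun y : E3 => ⟪y, u y⟫) x⟫ = 0 := by
  rw [gradient_inner_self hu hEu]
  obtain ⟨c0, c1, c2⟩ := cross_fin3 x (curl u x)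
  rw [inner_fin3, c0, c1, c2]
  ring

/-- ★ **The vorticity of the stratum is determined by its radial profile**: if moreover `⟪x, curl u(x)⟫ = 0` and `x ≠ 0`, then
`curl u(x) = (∇⟪x,u⟫(x) × x)/|x|²`. -/
theorem curl_eq_of_unthreaded (hu : HasFDerivAt u D x) (hEu : D x = -u x) (hx : x ≠ 0) (hrad : ⟪x, curl u x⟫ = 0) :
    curl u x = (‖x‖ ^ 2)⁻¹ • cross (gradient (fun y : E3 => ⟪y, u y⟫) x) x :=
  eq_inv_norm_sq_smul_cross_of_eq_cross hx hrad (gradient_inner_self hu hEu)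

end FirstOrder

/-! ### Second order: Euler for the gradient of a `0`-homogeneous function, and the Laplacian of the stratum -/

section SecondOrder

variable {U : Set E3} {x : E3}

/-- Regularity bookkeeping: a `C²` function on an open set has a differentiable gradient at each point, and `DF = ⟪∇F, ·⟫` there. -/
theorem hasFDerivAt_gradient_of_contDiffOn {F : E3 → ℝ} (hU : IsOpen U) (hF : ContDiffOn ℝ 2 F U) (hx : x ∈ U) :
    HasFDerivAt (gradient F) (fderiv ℝ (gradient F) x) x ∧ ∀ y ∈ U, HasFDerivAt F (innerSL ℝ (gradient F y)) y := by
  refine ⟨?_, fun y hy => ?_⟩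
  · have h2 : ContDiffAt ℝ 2 F x := hF.contDiffAt (hU.mem_nhds hx)
    have h1 : ContDiffAt ℝ 1 (fderiv ℝ F) x := h2.fderiv_right (m := 1) (by norm_num)
    have hg : ContDiffAt ℝ 1 (gradient F) x := by
      have e : gradient F = fun y => (InnerProductSpace.toDual ℝ E3).symm (fderiv ℝ F y) := rfl
      rw [e]
      exact (InnerProductSpace.toDual ℝ E3).symm.toContinuousLinearEquiv.contDiff.contDiffAt.comp x h1
    exact (hg.differentiableAt (by norm_num)).hasFDerivAt
  · have hd : DifferentiableAt ℝ F y := (hF.contDiffAt (hU.mem_nhds hy)).differentiableAt (by norm_num)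
    rw [← fderiv_eq_innerSL_gradient']
    exact hd.hasFDerivAt

/-- **Euler's relation for the gradient of a `0`-homogeneous function, locally.**  If `F ∈ C²(U)` satisfies `⟪y, ∇F(y)⟫ = 0` on the
open set `U`, then `D(∇F)(x) x = −∇F(x)` for `x ∈ U` (differentiate `⟪y, ∇F(y)⟫ ≡ 0` and use the symmetry of the Hessian). -/
theorem fderiv_gradient_apply_self_of_inner_gradient_eq_zero {F : E3 → ℝ} (hU : IsOpen U) (hF : ContDiffOn ℝ 2 F U)
    (hEu : ∀ y ∈ U, ⟪y, gradient F y⟫ = 0) (hx : x ∈ U) : fderiv ℝ (gradient F) x x = -gradient F x := by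
  obtain ⟨hH, hgrad⟩ := hasFDerivAt_gradient_of_contDiffOn hU hF hx
  set g : E3 → E3 := gradient F with hg_def
  set H : E3 →L[ℝ] E3 := fderiv ℝ g x with hH_def
  -- symmetry of the Hessian
  have hsymm : ∀ v w : E3, ⟪H v, w⟫ = ⟪v, H w⟫ := by
    intro v w
    have hev : ∀ᶠ y in 𝓝 x, HasFDerivAt F ((fun y => innerSL ℝ (g y)) y) y := by
      filter_upwards [hU.mem_nhds hx] with y hy using hgrad y hy
    have hx' : HasFDerivAt (fun y => innerSL ℝ (g y)) ((innerSL ℝ : E3 →L[ℝ] E3 →L[ℝ] ℝ).comp H) x :=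
      (innerSL ℝ : E3 →L[ℝ] E3 →L[ℝ] ℝ).hasFDerivAt.comp x hH
    have h := second_derivative_symmetric_of_eventually hev hx' v w
    simp only [ContinuousLinearMap.coe_comp, Function.comp_apply, innerSL_apply_apply] at h
    rw [h, real_inner_comm]
  -- Euler's relation differentiated: `⟪v, g x⟫ + ⟪x, H v⟫ = 0`
  have heu : ∀ v : E3, ⟪v, g x⟫ + ⟪x, H v⟫ = 0 := by
    intro v
    have hD : HasFDerivAt (fun y : E3 => ⟪y, g y⟫)
        ((fderivInnerCLM ℝ ((id x : E3), g x)).comp ((ContinuousLinearMap.id ℝ E3).prod H)) x :=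
      (hasFDerivAt_id x).inner ℝ hH
    have h0 : HasFDerivAt (fun y : E3 => ⟪y, g y⟫) (0 : E3 →L[ℝ] ℝ) x := by
      have hev : (fun y : E3 => ⟪y, g y⟫) =ᶠ[𝓝 x] fun _ => (0 : ℝ) := by
        filter_upwards [hU.mem_nhds hx] with y hy using hEu y hy
      exact (hasFDerivAt_const (0 : ℝ) x).congr_of_eventuallyEq hev
    have huniq := hD.unique h0
    have := congrArg (fun L : E3 →L[ℝ] ℝ => L v) huniq
    rw [add_comm]
    simpa [fderivInnerCLM_apply] using this
  have h : ∀ v : E3, ⟪H x + g x, v⟫ = 0 := fun v => by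
    rw [inner_add_left, hsymm, real_inner_comm v (g x)]
    linarith [heu v]
  have := h (H x + g x)
  rw [inner_self_eq_zero] at this
  exact eq_neg_of_add_eq_zero_left this

/-- The derivative of `y ↦ |y|⁻²` away from the origin: `⟪−2|x|⁻⁴ x, ·⟫`. -/
theorem hasFDerivAt_inv_norm_sq (hx : x ≠ 0) :
    HasFDerivAt (fun y : E3 => (‖y‖ ^ 2)⁻¹) (innerSL ℝ ((-2 * ((‖x‖ ^ 2) ^ 2)⁻¹) • x)) x := by
  have hne : ‖x‖ ^ 2 ≠ 0 := pow_ne_zero 2 (norm_ne_zero_iff.mpr hx)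
  have h1 : HasFDerivAt (fun y : E3 => ‖y‖ ^ 2) (2 • innerSL ℝ x) x := (hasStrictFDerivAt_norm_sq x).hasFDerivAt
  have h2 : HasFDerivAt (fun y : E3 => (‖y‖ ^ 2)⁻¹) ((ContinuousLinearMap.toSpanSingleton ℝ (-((‖x‖ ^ 2) ^ 2)⁻¹)).comp
      (2 • innerSL ℝ x)) x := (hasFDerivAt_inv hne).comp x h1
  refine h2.congr_fderiv ?_
  ext v
  simp only [ContinuousLinearMap.coe_comp, Function.comp_apply, smul_apply, innerSL_apply_apply,
    ContinuousLinearMap.toSpanSingleton_apply, smul_eq_mul, real_inner_smul_left]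
  ring

/-- ★★ **The Laplacian of the stratum.**  Let `u ∈ C²(U)` (`U` open) be divergence-free, `(−1)`-homogeneous (`Du(y) y = −u(y)`) and
unthreaded (`⟪y, curl u(y)⟫ = 0`) on `U`, and let `x ∈ U`, `x ≠ 0`.  With `F = ⟪·, u⟫`:  **`Δu(x) = (∇F(x) + (div ∇F)(x)·x)/|x|²`**
(`Δu = −curl ω` locally, `ω = (∇F × y)/|y|²` near `x`, and `curl` of that by the product rules). -/
theorem laplacian_eq_of_unthreaded {u : E3 → E3} (hU : IsOpen U) (hu : ContDiffOn ℝ 2 u U)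
    (hdiv : ∀ y ∈ U, VectorCalculus.divergence u y = 0) (hEu : ∀ y ∈ U, fderiv ℝ u y y = -u y)
    (hrad : ∀ y ∈ U, ⟪y, curl u y⟫ = 0) (hx : x ∈ U) (hx0 : x ≠ 0) :
    Laplacian.laplacian u x = (‖x‖ ^ 2)⁻¹ •
      (gradient (fun y : E3 => ⟪y, u y⟫) x + VectorCalculus.divergence (gradient fun y : E3 => ⟪y, u y⟫) x • x) := by
  set F : E3 → ℝ := fun y => ⟪y, u y⟫ with hF_def
  -- a ball inside `U ∖ {0}`
  obtain ⟨r, hr, hball⟩ := Metric.isOpen_iff.mp (hU.inter isOpen_ne) x ⟨hx, hx0⟩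
  have hbU : ball x r ⊆ U := fun y hy => (hball hy).1
  have hb0 : ∀ y ∈ ball x r, y ≠ 0 := fun y hy => (hball hy).2
  -- derivative data
  have hud : ∀ y ∈ U, HasFDerivAt u (fderiv ℝ u y) y := fun y hy =>
    ((hu.contDiffAt (hU.mem_nhds hy)).differentiableAt (by norm_num)).hasFDerivAt
  have hF2 : ContDiffOn ℝ 2 F U := contDiffOn_id.inner ℝ hu
  have hFEu : ∀ y ∈ U, ⟪y, gradient F y⟫ = 0 := fun y hy => inner_self_gradient_inner_self (hud y hy) (hEu y hy)
  obtain ⟨hH, -⟩ := hasFDerivAt_gradient_of_contDiffOn hU hF2 hx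
  have hgx : ⟪x, gradient F x⟫ = 0 := hFEu x hx
  -- the vorticity near `x`
  have hcurl : ∀ y ∈ ball x r, curl u y = (fun y : E3 => (‖y‖ ^ 2)⁻¹ • cross (gradient F y) y) y := fun y hy =>
    curl_eq_of_unthreaded (hud y (hbU hy)) (hEu y (hbU hy)) (hb0 y hy) (hrad y (hbU hy))
  -- `Δu = −curl ω`
  rw [laplacian_eq_neg_curl_local hr (hu.mono hbU) (fun y hy => hdiv y (hbU hy)) hcurl]
  -- `curl ω` by the product rules
  have hρ := hasFDerivAt_inv_norm_sq hx0
  have hA : HasFDerivAt (fun y : E3 => cross (gradient F y) y) _ x := hasFDerivAt_cross hH (hasFDerivAt_id x)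
  have hcs := curl_smul hρ.differentiableAt hA.differentiableAt
  rw [hρ.fderiv, curlCLM_smulRight_innerSL] at hcs
  have hcA : curl (fun y : E3 => cross (gradient F y) y) x =
      fderiv ℝ (gradient F) x x - VectorCalculus.divergence (gradient F) x • x + (3 : ℝ) • gradient F x - gradient F x := by
    have h := curl_cross_apply (W := gradient F) (Ω := fun y : E3 => y) hH.differentiableAt differentiableAt_id
    rw [divergence_id, fderiv_fun_id, ContinuousLinearMap.id_apply] at h
    exact h
  rw [hcs, hcA, fderiv_gradient_apply_self_of_inner_gradient_eq_zero hU hF2 hFEu hx, Literature.Analysis.FluidPDE.cross_smul_left,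
    cross_cross_eq, hgx,
    zero_smul, sub_zero, real_inner_self_eq_norm_sq, smul_smul]
  have hne : ‖x‖ ^ 2 ≠ 0 := pow_ne_zero 2 (norm_ne_zero_iff.mpr hx0)
  have hc : -2 * ((‖x‖ ^ 2) ^ 2)⁻¹ * ‖x‖ ^ 2 = -2 * (‖x‖ ^ 2)⁻¹ := by
    field_simp
  rw [hc]
  module

end SecondOrder

/-! ### The head is a first integral -/

section Head

variable {U : Set E3} {u : E3 → E3} {p : E3 → ℝ} {x : E3}

/-- ★★★ **Šverák's Bernoulli head is a first integral of the unthreaded `(−1)`-homogeneous steady stratum.**  Let `(u, p)` be a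
classical steady Navier–Stokes pair on the open set `U` (`IsSteadyNSOn U u p`), unthreaded about the vertex `0` (`IsUnthreadedOn U 0 u`),
`(−1)`-homogeneous about it (`IsMinusOneHomogeneousOn U 0 u`) with the pressure normalised `(−2)`-homogeneous (`Dp(y) y = −2p(y)` on `U`).
Then at every `x ∈ U`, `x ≠ 0`, the head `K = |x|²(½|u|² + p) − ½⟪x,u⟫² − ⟪x,u⟫` has derivative ZERO: `D(conicalHead u p)(x) = 0`.
[Šverák 2011 §4 shows `K ≡ const` on `S²` by a maximum principle; here the pointwise statement on any cone.] -/
theorem hasFDerivAt_conicalHead (hU : IsOpen U) (hNS : IsSteadyNSOn U u p) (hunth : IsUnthreadedOn U 0 u)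
    (hhom : IsMinusOneHomogeneousOn U 0 u) (hp : ∀ y ∈ U, fderiv ℝ p y y = -2 * p y) (hx : x ∈ U) (hx0 : x ≠ 0) :
    HasFDerivAt (conicalHead u p) (0 : E3 →L[ℝ] ℝ) x := by
  obtain ⟨hu3, hp1, hdiv, hns⟩ := hNS
  have hu2 : ContDiffOn ℝ 2 u U := hu3.of_le (by norm_num)
  have hEu : ∀ y ∈ U, fderiv ℝ u y y = -u y := fun y hy => by simpa using hhom y hy
  have hrad : ∀ y ∈ U, ⟪y, curl u y⟫ = 0 := fun y hy => by simpa using hunth y hy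
  have hne : ‖x‖ ^ 2 ≠ 0 := pow_ne_zero 2 (norm_ne_zero_iff.mpr hx0)
  -- derivative data at `x`
  set D : E3 →L[ℝ] E3 := fderiv ℝ u x with hD
  have hud : HasFDerivAt u D x := ((hu3.contDiffAt (hU.mem_nhds hx)).differentiableAt (by norm_num)).hasFDerivAt
  have hpd : HasFDerivAt p (fderiv ℝ p x) x := ((hp1.contDiffAt (hU.mem_nhds hx)).differentiableAt (by norm_num)).hasFDerivAt
  set F : E3 → ℝ := fun y => ⟪y, u y⟫ with hF_def
  set b : E3 := curl u x with hb_def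
  set g : E3 := cross x b with hg_def
  have hcurlD : curlCLM D = b := by rw [hb_def, curl_eq_curlCLM]
  have hFd : HasFDerivAt F (innerSL ℝ g) x := by
    have h := hasFDerivAt_inner_self hud (hEu x hx)
    rwa [hcurlD] at h
  have hgx : ⟪g, x⟫ = 0 := by
    obtain ⟨c0, c1, c2⟩ := cross_fin3 x b
    rw [hg_def, inner_fin3, c0, c1, c2]
    ring
  have hbg : b = (‖x‖ ^ 2)⁻¹ • cross g x := eq_inv_norm_sq_smul_cross_of_eq_cross hx0 (hrad x hx) rfl
  -- the Laplacian through `g` and `m = div ∇F`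
  set m : ℝ := VectorCalculus.divergence (gradient F) x with hm_def
  have hΔ : Laplacian.laplacian u x = (‖x‖ ^ 2)⁻¹ • (g + m • x) := by
    have h := laplacian_eq_of_unthreaded hU hu2 hdiv hEu hrad hx hx0
    rw [gradient_eq_of_hasFDerivAt_innerSL hFd] at h
    exact h
  set ρ : ℝ := (‖x‖ ^ 2)⁻¹ with hρ_def
  have en : ρ * ‖x‖ ^ 2 = 1 := inv_mul_cancel₀ hne
  -- (a) the spin identity for `u`
  have ea : ∀ w : E3, ⟪u x, D w⟫ = ⟪D (u x), w⟫ + ⟪cross (u x) b, w⟫ := fun w => by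
    have h := inner_apply_sub_inner_apply_eq D (u x) w
    rw [hcurlD] at h
    linarith
  -- (b) the momentum equation paired with `w`
  have eb : ∀ w : E3, ⟪D (u x), w⟫ + fderiv ℝ p x w = ρ * (⟪g, w⟫ + m * ⟪x, w⟫) := fun w => by
    have h := congrArg (fun v : E3 => ⟪v, w⟫) (hns x hx)
    rw [hΔ, inner_add_left, real_inner_smul_left, inner_add_left, real_inner_smul_left] at h
    rw [fderiv_eq_innerSL_gradient', innerSL_apply_apply]
    exact h
  -- (c) `u × ω` through `g`
  have ec : ∀ w : E3, ⟪cross (u x) b, w⟫ = ρ * (F x * ⟪g, w⟫ - ⟪u x, g⟫ * ⟪x, w⟫) := fun w => by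
    rw [hbg, Literature.Analysis.FluidPDE.cross_smul_right, cross_cross_eq, real_inner_smul_left, inner_sub_left, real_inner_smul_left, real_inner_smul_left,
      real_inner_comm x (u x)]
  -- (e) the radial momentum balance
  have ee : ⟪u x, g⟫ = m + 2 * p x + ‖u x‖ ^ 2 := by
    have h1 := ea x
    have h2 := eb x
    have h3 := ec x
    rw [hEu x hx, inner_neg_right, real_inner_self_eq_norm_sq] at h1
    rw [hp x hx, hgx, real_inner_self_eq_norm_sq] at h2
    rw [hgx, real_inner_self_eq_norm_sq] at h3
    linear_combination h1 + h2 + h3 - (⟪u x, g⟫ - m) * en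
  -- the derivative of the head, and its vanishing
  have hN : HasFDerivAt (fun y : E3 => ‖y‖ ^ 2) (2 • innerSL ℝ x) x := (hasStrictFDerivAt_norm_sq x).hasFDerivAt
  have hK : HasFDerivAt (fun y : E3 => ‖y‖ ^ 2 * (‖u y‖ ^ 2 * 2⁻¹ + p y) - F y ^ 2 * 2⁻¹ - F y)
      (‖x‖ ^ 2 • ((2⁻¹ : ℝ) • (2 • (innerSL ℝ (u x)).comp D) + fderiv ℝ p x) +
        (‖u x‖ ^ 2 * 2⁻¹ + p x) • (2 • innerSL ℝ x) - (2⁻¹ : ℝ) • ((2 • F x ^ (2 - 1)) • innerSL ℝ g) - innerSL ℝ g) x :=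
    ((hN.mul ((hud.norm_sq.mul_const (2⁻¹ : ℝ)).add hpd)).sub ((hFd.pow 2).mul_const (2⁻¹ : ℝ))).sub hFd
  have hfun : conicalHead u p = fun y : E3 => ‖y‖ ^ 2 * (‖u y‖ ^ 2 * 2⁻¹ + p y) - F y ^ 2 * 2⁻¹ - F y := by
    funext y
    simp only [conicalHead, hF_def, div_eq_mul_inv]
  rw [hfun]
  refine hK.congr_fderiv ?_
  ext w
  simp only [sub_apply, add_apply, smul_apply, ContinuousLinearMap.coe_comp, Function.comp_apply, innerSL_apply_apply, zero_apply,
    smul_eq_mul, nsmul_eq_mul, Nat.cast_ofNat, pow_one, Nat.add_one_sub_one]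
  linear_combination ‖x‖ ^ 2 * ea w + ‖x‖ ^ 2 * eb w + ‖x‖ ^ 2 * ec w +
    (⟪g, w⟫ + m * ⟪x, w⟫ + F x * ⟪g, w⟫ - ⟪u x, g⟫ * ⟪x, w⟫) * en - ⟪x, w⟫ * ee

/-- The `fderiv` form: `fderiv (conicalHead u p) x = 0`. -/
theorem fderiv_conicalHead (hU : IsOpen U) (hNS : IsSteadyNSOn U u p) (hunth : IsUnthreadedOn U 0 u)
    (hhom : IsMinusOneHomogeneousOn U 0 u) (hp : ∀ y ∈ U, fderiv ℝ p y y = -2 * p y) (hx : x ∈ U) (hx0 : x ≠ 0) :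
    fderiv ℝ (conicalHead u p) x = 0 :=
  (hasFDerivAt_conicalHead hU hNS hunth hhom hp hx hx0).fderiv

/-- ★ **On a preconnected cone the head is a constant `k₀`** (Šverák's `k₀`; `= 0` exactly on the image of the conformal correspondence,
Λ4a `LiouvilleCone.conicalHead_eq_zero`; `= β − β²/2` on the Slezkin flows, Λ4c `conicalHead_slezkin`). -/
theorem exists_conicalHead_eq_const (hU : IsOpen U) (hUc : IsPreconnected U) (h0 : ∀ y ∈ U, y ≠ 0) (hNS : IsSteadyNSOn U u p)
    (hunth : IsUnthreadedOn U 0 u) (hhom : IsMinusOneHomogeneousOn U 0 u) (hp : ∀ y ∈ U, fderiv ℝ p y y = -2 * p y) :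
    ∃ k₀ : ℝ, ∀ y ∈ U, conicalHead u p y = k₀ :=
  hU.exists_is_const_of_fderiv_eq_zero hUc
    (fun y hy => (hasFDerivAt_conicalHead hU hNS hunth hhom hp hy (h0 y hy)).differentiableAt.differentiableWithinAt)
    (fun y hy => fderiv_conicalHead hU hNS hunth hhom hp hy (h0 y hy))

end Head

/-! ### The head obstruction with its constancy hypothesis discharged -/

namespace LiouvilleCone

variable {U : Set E3} {Φ : E3 → ℝ} {g : E3 → E3} {H : E3 → E3 →L[ℝ] E3} (hc : LiouvilleCone U Φ g H)
include hc

/-- ★ **HEAD OBSTRUCTION, pointwise form.**  On the (preconnected) cone `U` of some Liouville data, a classical steady pair `(V, p)` which is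
unthreaded and `(−1)`-homogeneous about the vertex with `(−2)`-homogeneous pressure, and whose head is non-zero AT ONE POINT of `U`, is not
the conical field of the data: `V x ≠ conicalField Φ x` somewhere on `U` (Λ4a `exists_ne_conicalField_of_conicalHead` + constancy). -/
theorem exists_ne_conicalField_of_conicalHead_ne_zero (hUc : IsPreconnected U) {V : E3 → E3} {p : E3 → ℝ} (hV : IsSteadyNSOn U V p)
    (hunth : IsUnthreadedOn U 0 V) (hhom : IsMinusOneHomogeneousOn U 0 V) (hp : ∀ y ∈ U, fderiv ℝ p y y = -2 * p y) {x₁ : E3}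
    (hx₁ : x₁ ∈ U) (hk : conicalHead V p x₁ ≠ 0) : ∃ x ∈ U, V x ≠ conicalField Φ x := by
  obtain ⟨k₀, hk₀⟩ := exists_conicalHead_eq_const hc.isOpen hUc hc.ne_zero hV hunth hhom hp
  have hk0 : k₀ ≠ 0 := by
    rw [← hk₀ x₁ hx₁]
    exact hk
  exact hc.exists_ne_conicalField_of_conicalHead ⟨x₁, hx₁⟩ hV hk0 hk₀

end LiouvilleCone

end Summit.NavierStokesRegularity.NavierStokesRegularity.Theorems.PoloidalLiouville.AzimuthalCartan

end
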